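import Mathlib
import Summits.MatrixMultiplication.MatrixMultiplication.Theorems.SubgroupIdentityDesigns.Negative.OrbitPair
import Summits.MatrixMultiplication.MatrixMultiplication.Theorems.SubgroupIdentityDesigns.Negative.DecoratedSylowShapes

/-!
# The norm-one torus certificate: a member containing `O₂⁻(𝔽_p)` carries no level-one design

Route `LevelGradedCohnUmans`, crux `SubgroupIdentityDesigns`, the `(m,k) = (2,1)` cell, `p`-FREE
case (all odd `p`; after `CellStatus` this is all that is left of the cell for `0 < ε ≤ 1`).

1. `orbitPair_of_free`, `no_levelOne_design_of_free_subgroup₁/₂/₃` (all `p`): for a SUBGROUP `K`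
   acting freely on non-zero vectors, the re-indexing bijections of `OrbitPair` come for free from
   `∀ a ≠ 0, ∀ k ∈ K, ∃ k' ∈ K, k₀ k' a = k a`; so a member containing such a `K` and some
   `k₀ ∉ K` with this property admits no level-`1` identity design (no TPP, no volume hypothesis).
2. `no_levelOne_design_of_normOne_torus₂` (`p` odd): fix a non-square `n` and the anisotropic
   form `Q(a) = a₀² - n a₁²`.  The norm-one torus `K = SO(Q) = {[[x, n y],[y, x]] : x² - n y² = 1}`
   (`≅ C_{p+1}`) acts freely (`shape_kernel`), and for `k ∈ K`, `a ≠ 0` the explicit element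
   `k' = M(σ k a)·M(a)⁻¹ ∈ K` (`M(t) = [[t₀, n t₁],[t₁, t₀]]`, `σ = diag(1,-1)`) has
   `σ k' a = k a`.  Hence: if the middle member contains `SO(Q)` and `σ` (a copy of the dihedral
   group `O₂⁻(𝔽_p)` of order `2(p+1)`), the level-`1` identity design of the crux is impossible.

This is the first theorem excluding `p`-free triples above the volume floor (at `p = 7` both
observed `p`-free profiles have a member `⊇ D_{p+1}`; route folder `ORACLE-g14.md` §G14-17).
VALUE = THEOREM, NOT summit progress; the crux item stmt-MatrixMultiplication-14079 is untouched
and remains open.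
-/

set_option linter.dupNamespace false

noncomputable section

open scoped BigOperators Classical

open Summit.MatrixMultiplication.MatrixMultiplication.Theorems.LieRankDesigns.Negative (GLm Mat)

namespace Summit.MatrixMultiplication.MatrixMultiplication.Theorems.SubgroupIdentityDesigns.Negative

section FreeOrbit

variable {p : ℕ} [hp : Fact p.Prime]

/-- **Free + orbit-preserving ⇒ orbit pair.**  If `K` acts freely on non-zero vectors and for every
`k ∈ K` some `k' ∈ K` has `k₀ k' a = k a`, the re-indexing bijections of `OrbitPair` exist. -/
theorem orbitPair_of_free (K : Subgroup (GLm p 2)) (k₀ : GLm p 2)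
    (hfree : ∀ a : Fin 2 → ZMod p, a ≠ 0 → ∀ k ∈ K, ∀ k' ∈ K,
      ((k : GLm p 2) : Mat p 2).mulVec a = ((k' : GLm p 2) : Mat p 2).mulVec a → k = k')
    (hex : ∀ a : Fin 2 → ZMod p, a ≠ 0 → ∀ k ∈ K, ∃ k' ∈ K,
      ((k₀ * k' : GLm p 2) : Mat p 2).mulVec a = ((k : GLm p 2) : Mat p 2).mulVec a)
    (a : Fin 2 → ZMod p) (ha : a ≠ 0) :
    ∃ e : (K : Set (GLm p 2)).toFinset ≃ (K : Set (GLm p 2)).toFinset,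
      ∀ k : (K : Set (GLm p 2)).toFinset,
        ((k₀ * (e k : GLm p 2) : GLm p 2) : Mat p 2).mulVec a =
          ((k : GLm p 2) : Mat p 2).mulVec a := by
  set KF := (K : Set (GLm p 2)).toFinset with hKF
  have hmem : ∀ {k : GLm p 2}, k ∈ KF ↔ k ∈ K := fun {k} => by
    rw [hKF, Set.mem_toFinset]; rfl
  -- the re-indexing map
  have hch : ∀ k : KF, ∃ k' : KF,
      ((k₀ * (k' : GLm p 2) : GLm p 2) : Mat p 2).mulVec a = ((k : GLm p 2) : Mat p 2).mulVec a :=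
    fun k => by
      obtain ⟨k', hk', e⟩ := hex a ha k (hmem.mp k.2)
      exact ⟨⟨k', hmem.mpr hk'⟩, e⟩
  choose f hf using hch
  have hinj : Function.Injective f := by
    intro k₁ k₂ h
    have e₁ := hf k₁
    have e₂ := hf k₂
    rw [h] at e₁
    have e : ((k₁ : GLm p 2) : Mat p 2).mulVec a = ((k₂ : GLm p 2) : Mat p 2).mulVec a :=
      e₁.symm.trans e₂
    exact Subtype.ext (hfree a ha _ (hmem.mp k₁.2) _ (hmem.mp k₂.2) e)
  have hbij : Function.Bijective f := Finite.injective_iff_bijective.mp hinj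
  exact ⟨Equiv.ofBijective f hbij, fun k => hf k⟩

/-- **No level-one identity design from a free, orbit-preserved subgroup of the MIDDLE member.** -/
theorem no_levelOne_design_of_free_subgroup₂ {H₁ H₂ H₃ : Subgroup (GLm p 2)}
    (K : Subgroup (GLm p 2)) (k₀ : GLm p 2) (hKH : K ≤ H₂) (hk₀ : k₀ ∈ H₂) (hk₀K : k₀ ∉ K)
    (hfree : ∀ a : Fin 2 → ZMod p, a ≠ 0 → ∀ k ∈ K, ∀ k' ∈ K,
      ((k : GLm p 2) : Mat p 2).mulVec a = ((k' : GLm p 2) : Mat p 2).mulVec a → k = k')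
    (hex : ∀ a : Fin 2 → ZMod p, a ≠ 0 → ∀ k ∈ K, ∃ k' ∈ K,
      ((k₀ * k' : GLm p 2) : Mat p 2).mulVec a = ((k : GLm p 2) : Mat p 2).mulVec a) :
    ¬ ∃ c : Mat p 2 → ℂ, (∀ M, 1 < M.rank → c M = 0) ∧
      (∑ M, c M * ZMod.stdAddChar (Matrix.trace (M * ((1 : GLm p 2) : Mat p 2)))) = 1 ∧
      ∀ a ∈ H₁, ∀ b ∈ H₂, ∀ g ∈ H₃, a * b * g ≠ 1 →
        (∑ M, c M *
          ZMod.stdAddChar (Matrix.trace (M * ((a * b * g : GLm p 2) : Mat p 2)))) = 0 := by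
  have hmem : ∀ {k : GLm p 2}, k ∈ (K : Set (GLm p 2)).toFinset ↔ k ∈ K := fun {k} => by
    rw [Set.mem_toFinset]; rfl
  refine no_levelOne_design_of_orbit_pair_mem₂ (K : Set (GLm p 2)).toFinset k₀
    (fun k hk => hKH (hmem.mp hk)) hk₀ (hmem.mpr K.one_mem) (fun k hk e => ?_)
    (orbitPair_of_free K k₀ hfree hex)
  exact hk₀K (by rw [eq_inv_of_mul_eq_one_left e]; exact K.inv_mem (hmem.mp hk))

/-- The same inside the FIRST member. -/
theorem no_levelOne_design_of_free_subgroup₁ {H₁ H₂ H₃ : Subgroup (GLm p 2)}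
    (K : Subgroup (GLm p 2)) (k₀ : GLm p 2) (hKH : K ≤ H₁) (hk₀ : k₀ ∈ H₁) (hk₀K : k₀ ∉ K)
    (hfree : ∀ a : Fin 2 → ZMod p, a ≠ 0 → ∀ k ∈ K, ∀ k' ∈ K,
      ((k : GLm p 2) : Mat p 2).mulVec a = ((k' : GLm p 2) : Mat p 2).mulVec a → k = k')
    (hex : ∀ a : Fin 2 → ZMod p, a ≠ 0 → ∀ k ∈ K, ∃ k' ∈ K,
      ((k₀ * k' : GLm p 2) : Mat p 2).mulVec a = ((k : GLm p 2) : Mat p 2).mulVec a) :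
    ¬ ∃ c : Mat p 2 → ℂ, (∀ M, 1 < M.rank → c M = 0) ∧
      (∑ M, c M * ZMod.stdAddChar (Matrix.trace (M * ((1 : GLm p 2) : Mat p 2)))) = 1 ∧
      ∀ a ∈ H₁, ∀ b ∈ H₂, ∀ g ∈ H₃, a * b * g ≠ 1 →
        (∑ M, c M *
          ZMod.stdAddChar (Matrix.trace (M * ((a * b * g : GLm p 2) : Mat p 2)))) = 0 := by
  have hmem : ∀ {k : GLm p 2}, k ∈ (K : Set (GLm p 2)).toFinset ↔ k ∈ K := fun {k} => by
    rw [Set.mem_toFinset]; rfl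
  refine no_levelOne_design_of_orbit_pair_mem₁ (K : Set (GLm p 2)).toFinset k₀
    (fun k hk => hKH (hmem.mp hk)) hk₀ (hmem.mpr K.one_mem) (fun k hk e => ?_)
    (orbitPair_of_free K k₀ hfree hex)
  exact hk₀K (by rw [eq_inv_of_mul_eq_one_left e]; exact K.inv_mem (hmem.mp hk))

/-- The same inside the LAST member. -/
theorem no_levelOne_design_of_free_subgroup₃ {H₁ H₂ H₃ : Subgroup (GLm p 2)}
    (K : Subgroup (GLm p 2)) (k₀ : GLm p 2) (hKH : K ≤ H₃) (hk₀ : k₀ ∈ H₃) (hk₀K : k₀ ∉ K)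
    (hfree : ∀ a : Fin 2 → ZMod p, a ≠ 0 → ∀ k ∈ K, ∀ k' ∈ K,
      ((k : GLm p 2) : Mat p 2).mulVec a = ((k' : GLm p 2) : Mat p 2).mulVec a → k = k')
    (hex : ∀ a : Fin 2 → ZMod p, a ≠ 0 → ∀ k ∈ K, ∃ k' ∈ K,
      ((k₀ * k' : GLm p 2) : Mat p 2).mulVec a = ((k : GLm p 2) : Mat p 2).mulVec a) :
    ¬ ∃ c : Mat p 2 → ℂ, (∀ M, 1 < M.rank → c M = 0) ∧
      (∑ M, c M * ZMod.stdAddChar (Matrix.trace (M * ((1 : GLm p 2) : Mat p 2)))) = 1 ∧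
      ∀ a ∈ H₁, ∀ b ∈ H₂, ∀ g ∈ H₃, a * b * g ≠ 1 →
        (∑ M, c M *
          ZMod.stdAddChar (Matrix.trace (M * ((a * b * g : GLm p 2) : Mat p 2)))) = 0 := by
  have hmem : ∀ {k : GLm p 2}, k ∈ (K : Set (GLm p 2)).toFinset ↔ k ∈ K := fun {k} => by
    rw [Set.mem_toFinset]; rfl
  refine no_levelOne_design_of_orbit_pair_mem₃ (K : Set (GLm p 2)).toFinset k₀
    (fun k hk => hKH (hmem.mp hk)) hk₀ (hmem.mpr K.one_mem) (fun k hk e => ?_)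
    (orbitPair_of_free K k₀ hfree hex)
  exact hk₀K (by rw [eq_inv_of_mul_eq_one_left e]; exact K.inv_mem (hmem.mp hk))

end FreeOrbit

section NormOneTorus

variable {p : ℕ} [hp : Fact p.Prime]

/-- Anisotropy of `X² - n Y²` for a non-square `n`. -/
theorem anisotropic_of_nonsquare {n : ZMod p} (hn : ∀ x : ZMod p, x * x ≠ n) {X Y : ZMod p}
    (h : X * X = n * (Y * Y)) : X = 0 ∧ Y = 0 := by
  by_cases hY : Y = 0
  · subst hY
    have hX : X * X = 0 := by rw [h]; ring
    exact ⟨mul_self_eq_zero.mp hX, rfl⟩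
  · exfalso
    apply hn (X * Y⁻¹)
    have hYY : Y * Y ≠ 0 := mul_ne_zero hY hY
    calc X * Y⁻¹ * (X * Y⁻¹) = X * X * (Y * Y)⁻¹ := by rw [mul_inv]; ring
      _ = n := by rw [h]; exact mul_inv_cancel_right₀ hYY n

/-- The kernel of a non-zero matrix `[[X, nY],[Y, X]]` is trivial (anisotropy). -/
theorem shape_kernel {n : ZMod p} (hn : ∀ x : ZMod p, x * x ≠ n) {X Y : ZMod p}
    {a : Fin 2 → ZMod p} (ha : a ≠ 0) (h0 : X * a 0 + n * Y * a 1 = 0)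
    (h1 : Y * a 0 + X * a 1 = 0) : X = 0 ∧ Y = 0 := by
  have hQ0 : (X * X - n * (Y * Y)) * a 0 = 0 := by linear_combination X * h0 - n * Y * h1
  have hQ1 : (X * X - n * (Y * Y)) * a 1 = 0 := by linear_combination X * h1 - Y * h0
  by_cases hD : X * X - n * (Y * Y) = 0
  · exact anisotropic_of_nonsquare hn (sub_eq_zero.mp hD)
  · exfalso
    apply ha
    funext i
    fin_cases i
    · simpa using (mul_eq_zero.mp hQ0).resolve_left hD
    · simpa using (mul_eq_zero.mp hQ1).resolve_left hD

/-- Entries of `M.mulVec a` for `2 × 2` matrices. -/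
theorem mulVec_two_apply_zero (M : Mat p 2) (a : Fin 2 → ZMod p) :
    M.mulVec a 0 = M 0 0 * a 0 + M 0 1 * a 1 := by
  simp [Matrix.mulVec, dotProduct, Fin.sum_univ_two]

/-- Entries of `M.mulVec a` for `2 × 2` matrices. -/
theorem mulVec_two_apply_one (M : Mat p 2) (a : Fin 2 → ZMod p) :
    M.mulVec a 1 = M 1 0 * a 0 + M 1 1 * a 1 := by
  simp [Matrix.mulVec, dotProduct, Fin.sum_univ_two]

/-- Clearing denominators in the norm form. -/
theorem div_form_eq_one {n N₁ N₂ Q : ZMod p} (hQ : Q ≠ 0) (hB : N₁ * N₁ - n * (N₂ * N₂) = Q * Q) :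
    N₁ / Q * (N₁ / Q) - n * (N₂ / Q * (N₂ / Q)) = 1 := by
  rw [div_mul_div_comm, div_mul_div_comm, ← mul_div_assoc, ← sub_div, hB,
    div_self (mul_ne_zero hQ hQ)]

/-- Clearing denominators in the norm form (left-associated variant). -/
theorem div_form_eq_one' {n N₁ N₂ Q : ZMod p} (hQ : Q ≠ 0) (hB : N₁ * N₁ - n * (N₂ * N₂) = Q * Q) :
    N₁ / Q * (N₁ / Q) - n * (N₂ / Q) * (N₂ / Q) = 1 := by
  rw [mul_assoc]
  exact div_form_eq_one hQ hB

/-- **NO LEVEL-ONE IDENTITY DESIGN WHEN THE MIDDLE MEMBER CONTAINS `O₂⁻(𝔽_p)`** (`p` odd):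
`K = SO(Q)` for `Q = a₀² - n a₁²` (`n` a non-square), `K ≤ H₂`, and `σ = diag(1,-1) ∈ H₂`.
All odd `p`; no TPP and no volume hypothesis. -/
theorem no_levelOne_design_of_normOne_torus₂ {H₁ H₂ H₃ : Subgroup (GLm p 2)} (hp2 : p ≠ 2)
    (n : ZMod p) (hn : ∀ x : ZMod p, x * x ≠ n) (K : Subgroup (GLm p 2))
    (hKshape : ∀ k ∈ K, ((k : GLm p 2) : Mat p 2) 0 1 = n * ((k : GLm p 2) : Mat p 2) 1 0 ∧
      ((k : GLm p 2) : Mat p 2) 1 1 = ((k : GLm p 2) : Mat p 2) 0 0 ∧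
      ((k : GLm p 2) : Mat p 2) 0 0 * ((k : GLm p 2) : Mat p 2) 0 0 -
        n * (((k : GLm p 2) : Mat p 2) 1 0 * ((k : GLm p 2) : Mat p 2) 1 0) = 1)
    (hKall : ∀ k : GLm p 2, (k : Mat p 2) 0 1 = n * (k : Mat p 2) 1 0 →
      (k : Mat p 2) 1 1 = (k : Mat p 2) 0 0 →
      (k : Mat p 2) 0 0 * (k : Mat p 2) 0 0 - n * ((k : Mat p 2) 1 0 * (k : Mat p 2) 1 0) = 1 →
      k ∈ K)
    (hKH : K ≤ H₂) (s : GLm p 2) (hs : s ∈ H₂) (hs00 : (s : Mat p 2) 0 0 = 1)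
    (hs01 : (s : Mat p 2) 0 1 = 0) (hs10 : (s : Mat p 2) 1 0 = 0) (hs11 : (s : Mat p 2) 1 1 = -1) :
    ¬ ∃ c : Mat p 2 → ℂ, (∀ M, 1 < M.rank → c M = 0) ∧
      (∑ M, c M * ZMod.stdAddChar (Matrix.trace (M * ((1 : GLm p 2) : Mat p 2)))) = 1 ∧
      ∀ a ∈ H₁, ∀ b ∈ H₂, ∀ g ∈ H₃, a * b * g ≠ 1 →
        (∑ M, c M *
          ZMod.stdAddChar (Matrix.trace (M * ((a * b * g : GLm p 2) : Mat p 2)))) = 0 := by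
  refine no_levelOne_design_of_free_subgroup₂ K s hKH hs ?_ ?_ ?_
  · -- `σ ∉ K`: the shape forces `σ₀₀ = σ₁₁`, i.e. `1 = -1`, i.e. `p = 2`
    intro hsK
    have h := (hKshape s hsK).2.1
    rw [hs00, hs11] at h
    have h2 : ((2 : ℕ) : ZMod p) = 0 := by
      have : (2 : ZMod p) = 0 := by linear_combination -h
      exact_mod_cast this
    rw [CharP.cast_eq_zero_iff (ZMod p) p] at h2
    exact hp2 ((Nat.prime_dvd_prime_iff_eq hp.out Nat.prime_two).mp h2)
  · -- freeness
    intro a ha k hk k' hk' e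
    obtain ⟨h01, h11, -⟩ := hKshape k hk
    obtain ⟨h01', h11', -⟩ := hKshape k' hk'
    have e0 := congr_fun e 0
    have e1 := congr_fun e 1
    rw [mulVec_two_apply_zero, mulVec_two_apply_zero] at e0
    rw [mulVec_two_apply_one, mulVec_two_apply_one] at e1
    obtain ⟨hX, hY⟩ := shape_kernel hn ha
      (X := ((k : GLm p 2) : Mat p 2) 0 0 - ((k' : GLm p 2) : Mat p 2) 0 0)
      (Y := ((k : GLm p 2) : Mat p 2) 1 0 - ((k' : GLm p 2) : Mat p 2) 1 0)
      (by linear_combination e0 - a 1 * h01 + a 1 * h01')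
      (by linear_combination e1 - a 1 * h11 + a 1 * h11')
    have hX' := sub_eq_zero.mp hX
    have hY' := sub_eq_zero.mp hY
    exact gl2_ext hX' (by rw [h01, h01', hY']) hY' (by rw [h11, h11', hX'])
  · -- transport: `k' = M(σ k a) M(a)⁻¹`
    intro a ha k hk
    obtain ⟨h01, h11, hdet⟩ := hKshape k hk
    have hQ : a 0 * a 0 - n * (a 1 * a 1) ≠ 0 := by
      intro hQ
      obtain ⟨h0, h1⟩ := anisotropic_of_nonsquare hn (sub_eq_zero.mp hQ)
      apply ha
      funext i
      fin_cases i
      · simpa using h0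
      · simpa using h1
    -- name the entries; `t₀ = x a₀ + n y a₁`, `t₁ = -(y a₀ + x a₁)`, `Q = a₀² - n a₁²`
    set x := ((k : GLm p 2) : Mat p 2) 0 0 with hx
    set y := ((k : GLm p 2) : Mat p 2) 1 0 with hy
    have hB : ((x * a 0 + n * y * a 1) * a 0 - n * (-(y * a 0 + x * a 1)) * a 1) *
          ((x * a 0 + n * y * a 1) * a 0 - n * (-(y * a 0 + x * a 1)) * a 1) -
        n * ((-(y * a 0 + x * a 1) * a 0 - (x * a 0 + n * y * a 1) * a 1) *
          (-(y * a 0 + x * a 1) * a 0 - (x * a 0 + n * y * a 1) * a 1)) =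
        (a 0 * a 0 - n * (a 1 * a 1)) * (a 0 * a 0 - n * (a 1 * a 1)) := by
      linear_combination (a 0 * a 0 - n * (a 1 * a 1)) * (a 0 * a 0 - n * (a 1 * a 1)) * hdet
    have hdet1 := div_form_eq_one hQ hB
    obtain ⟨k', h00', h01', h10', h11'⟩ := exists_gl2
      (((x * a 0 + n * y * a 1) * a 0 - n * (-(y * a 0 + x * a 1)) * a 1) /
        (a 0 * a 0 - n * (a 1 * a 1)))
      (n * (((-(y * a 0 + x * a 1)) * a 0 - (x * a 0 + n * y * a 1) * a 1) /
        (a 0 * a 0 - n * (a 1 * a 1))))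
      (((-(y * a 0 + x * a 1)) * a 0 - (x * a 0 + n * y * a 1) * a 1) /
        (a 0 * a 0 - n * (a 1 * a 1)))
      (((x * a 0 + n * y * a 1) * a 0 - n * (-(y * a 0 + x * a 1)) * a 1) /
        (a 0 * a 0 - n * (a 1 * a 1)))
      (by rw [div_form_eq_one' hQ hB]; exact one_ne_zero)
    have hdet' : (k' : Mat p 2) 0 0 * (k' : Mat p 2) 0 0 -
        n * ((k' : Mat p 2) 1 0 * (k' : Mat p 2) 1 0) = 1 := by
      rw [h00', h10']
      exact hdet1
    refine ⟨k', hKall k' (by rw [h01', h10']) (by rw [h11', h00']) hdet', ?_⟩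
    -- `σ k' a = k a`
    have hv0 : (k' : Mat p 2).mulVec a 0 = x * a 0 + n * y * a 1 := by
      rw [mulVec_two_apply_zero, h00', h01']
      rw [show ∀ N₁ N₂ : ZMod p, N₁ / (a 0 * a 0 - n * (a 1 * a 1)) * a 0 +
          n * (N₂ / (a 0 * a 0 - n * (a 1 * a 1))) * a 1 =
          (N₁ * a 0 + n * N₂ * a 1) / (a 0 * a 0 - n * (a 1 * a 1)) from fun _ _ => by ring]
      rw [div_eq_iff hQ]
      ring
    have hv1 : (k' : Mat p 2).mulVec a 1 = -(y * a 0 + x * a 1) := by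
      rw [mulVec_two_apply_one, h10', h11']
      rw [show ∀ N₁ N₂ : ZMod p, N₂ / (a 0 * a 0 - n * (a 1 * a 1)) * a 0 +
          N₁ / (a 0 * a 0 - n * (a 1 * a 1)) * a 1 =
          (N₂ * a 0 + N₁ * a 1) / (a 0 * a 0 - n * (a 1 * a 1)) from fun _ _ => by ring]
      rw [div_eq_iff hQ]
      ring
    rw [Units.val_mul, ← Matrix.mulVec_mulVec]
    funext i
    fin_cases i
    · simp only [Fin.zero_eta, Fin.isValue]
      rw [mulVec_two_apply_zero, hs00, hs01, hv0, hv1, mulVec_two_apply_zero, h01]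
      ring
    · simp only [Fin.mk_one, Fin.isValue]
      rw [mulVec_two_apply_one, hs10, hs11, hv0, hv1, mulVec_two_apply_one, h11]
      ring

end NormOneTorus

end Summit.MatrixMultiplication.MatrixMultiplication.Theorems.SubgroupIdentityDesigns.Negative

end
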